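import Mathlib
import HarnessLib
import HarnessLib.Audit.Tags

/-!
# QuantumFields / YangMills — convexity transfers free-energy asymptotics to energy asymptotics
(solo seat `solo-QuantumFields-informed`, session 10)

Glue for the seat's "thermodynamic lever" (paper/nonfreezing.md v2.5 §10, Lemma 10.2 and Theorem D).
The lattice Yang–Mills free energy per site `F_S(β) = n⁻⁴ log Z_S(β)` on the torus `(ℤ/n)⁴` is CONVEX in
the inverse coupling `β` and `−F_S′(β)/6` is the mean plaquette energy.  Chatterjee's leading-order
asymptotics [S. Chatterjee, *The leading term of the Yang–Mills free energy*, J. Funct. Anal. 271 (2016),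
arXiv:1602.01222, Thm 2.1] give `F(β) + B log β → K` uniformly in the volume (`B = 3 dim G / 2`); the
elementary real-analysis fact recorded here turns that into `β F′(β) → −B`, i.e. the plaquette energy is
`(dim G / 4) β⁻¹ (1 + o(1))` uniformly in the volume — the thermodynamic half of "compute the plaquette two
ways", whose other half (the clean-box lower bound) then forces the box background variance to be `o(β⁻¹)`.

Contents (sorry-free, no facts, pure real analysis):
* `mul_deriv_le_sub_of_convexOn`, `sub_le_mul_deriv_of_convexOn` — chord inequalities
  `θβ F′(β) ≤ F((1+θ)β) − F(β)` and `F(β) − F((1−θ)β) ≤ θβ F′(β)` for `F` convex on `(0, ∞)`;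
* four elementary logarithm bounds on `[0, 1/2]`;
* `abs_mul_deriv_add_le_of_convexOn` — the quantitative three-point estimate
  `|β F′(β) + B| ≤ 2|B|θ + 2ε/θ` from `|F(x) + B log x − K| ≤ ε` at `x = (1−θ)β, β, (1+θ)β`;
* `deriv_asymp_uniform_of_convexOn` — the UNIFORM family version over a down-closed admissible set
  (the form used for the tori: admissible = "side ≥ β^{1+υ}");
* `tendsto_mul_deriv_of_convexOn` — single function: `F(β) + B log β → K ⇒ β F′(β) → −B`.

Informal companion: the seat's `paper/nonfreezing.md` v2.5 §10.2.
-/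

open Filter Topology Set

noncomputable section

namespace Summit.QuantumFields.YangMills.Theorems

/-! ### Chord inequalities for a convex function on `(0, ∞)` -/

/-- Upper chord: `θ β F′(β) ≤ F((1+θ)β) − F(β)` for `F` convex on `(0,∞)`, `β, θ > 0`. -/
theorem mul_deriv_le_sub_of_convexOn {F : ℝ → ℝ} {β θ : ℝ}
    (hconv : ConvexOn ℝ (Ioi 0) F) (hβ : 0 < β) (hθ : 0 < θ)
    (hdiff : DifferentiableAt ℝ F β) :
    θ * β * deriv F β ≤ F ((1 + θ) * β) - F β := by
  have hlt : β < (1 + θ) * β := by nlinarith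
  have hy : (1 + θ) * β ∈ Ioi (0:ℝ) := mem_Ioi.mpr (lt_trans hβ hlt)
  have h := hconv.deriv_le_slope (mem_Ioi.mpr hβ) hy hlt hdiff
  rw [slope_def_field] at h
  have hpos : 0 < (1 + θ) * β - β := by linarith
  rw [le_div_iff₀ hpos] at h
  have e : (1 + θ) * β - β = θ * β := by ring
  rw [e] at h
  calc θ * β * deriv F β = deriv F β * (θ * β) := by ring
    _ ≤ F ((1 + θ) * β) - F β := h

/-- Lower chord: `F(β) − F((1−θ)β) ≤ θ β F′(β)` for `F` convex on `(0,∞)`, `β > 0`, `0 < θ < 1`. -/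
theorem sub_le_mul_deriv_of_convexOn {F : ℝ → ℝ} {β θ : ℝ}
    (hconv : ConvexOn ℝ (Ioi 0) F) (hβ : 0 < β) (hθ : 0 < θ) (hθ1 : θ < 1)
    (hdiff : DifferentiableAt ℝ F β) :
    F β - F ((1 - θ) * β) ≤ θ * β * deriv F β := by
  have hx : 0 < (1 - θ) * β := mul_pos (by linarith) hβ
  have hlt : (1 - θ) * β < β := by nlinarith
  have h := hconv.slope_le_deriv (mem_Ioi.mpr hx) (mem_Ioi.mpr hβ) hlt hdiff
  rw [slope_def_field] at h
  have hpos : 0 < β - (1 - θ) * β := by linarith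
  rw [div_le_iff₀ hpos] at h
  have e : β - (1 - θ) * β = θ * β := by ring
  rw [e] at h
  calc F β - F ((1 - θ) * β) ≤ deriv F β * (θ * β) := h
    _ = θ * β * deriv F β := by ring

/-! ### Elementary logarithm bounds -/

/-- `log(1+θ) ≤ θ` for `θ ≥ 0`. -/
theorem log_one_add_le_of_nonneg {θ : ℝ} (hθ : 0 ≤ θ) : Real.log (1 + θ) ≤ θ := by
  have := Real.log_le_sub_one_of_pos (by linarith : (0:ℝ) < 1 + θ); linarith

/-- `θ − θ² ≤ log(1+θ)` for `θ ≥ 0`. -/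
theorem sub_sq_le_log_one_add_of_nonneg {θ : ℝ} (hθ : 0 ≤ θ) :
    θ - θ ^ 2 ≤ Real.log (1 + θ) := by
  have h1 : (0:ℝ) < 1 + θ := by linarith
  have h := Real.one_sub_inv_le_log_of_pos h1
  have h2 : θ - θ ^ 2 ≤ 1 - (1 + θ)⁻¹ := by
    have e : 1 - (1 + θ)⁻¹ = θ / (1 + θ) := by field_simp; ring
    rw [e, le_div_iff₀ h1]
    nlinarith [mul_nonneg hθ (sq_nonneg θ)]
  linarith

/-- `log(1−θ) ≤ −θ` for `θ < 1`. -/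
theorem log_one_sub_le_neg {θ : ℝ} (hθ1 : θ < 1) : Real.log (1 - θ) ≤ -θ := by
  have := Real.log_le_sub_one_of_pos (by linarith : (0:ℝ) < 1 - θ); linarith

/-- `−θ − 2θ² ≤ log(1−θ)` for `θ ≤ 1/2`. -/
theorem neg_sub_two_sq_le_log_one_sub {θ : ℝ} (hθ2 : θ ≤ 1 / 2) :
    -θ - 2 * θ ^ 2 ≤ Real.log (1 - θ) := by
  have h1 : (0:ℝ) < 1 - θ := by linarith
  have h := Real.one_sub_inv_le_log_of_pos h1
  have h2 : -θ - 2 * θ ^ 2 ≤ 1 - (1 - θ)⁻¹ := by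
    have e : 1 - (1 - θ)⁻¹ = -θ / (1 - θ) := by field_simp; ring
    rw [e, le_div_iff₀ h1]
    nlinarith [mul_nonneg (sq_nonneg θ) (by linarith : (0:ℝ) ≤ 1 - 2 * θ)]
  linarith

/-! ### The three-point estimate -/

/-- Quantitative form of Lemma 10.2 of the seat's paper: if `F` is convex on `(0,∞)`, differentiable at
`β > 0`, and `|F(x) + B log x − K| ≤ ε` at the three points `x = (1−θ)β, β, (1+θ)β` (`0 < θ ≤ 1/2`), then
`|β F′(β) + B| ≤ 2|B|θ + 2ε/θ`. -/
theorem abs_mul_deriv_add_le_of_convexOn {F : ℝ → ℝ} {B K ε β θ : ℝ}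
    (hconv : ConvexOn ℝ (Ioi 0) F) (hβ : 0 < β) (hθ : 0 < θ) (hθ2 : θ ≤ 1 / 2)
    (hdiff : DifferentiableAt ℝ F β)
    (hm : |F ((1 - θ) * β) + B * Real.log ((1 - θ) * β) - K| ≤ ε)
    (h0 : |F β + B * Real.log β - K| ≤ ε)
    (hp : |F ((1 + θ) * β) + B * Real.log ((1 + θ) * β) - K| ≤ ε) :
    |β * deriv F β + B| ≤ 2 * |B| * θ + 2 * ε / θ := by
  have hup := mul_deriv_le_sub_of_convexOn hconv hβ hθ hdiff
  have hlo := sub_le_mul_deriv_of_convexOn hconv hβ hθ (by linarith) hdiff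
  have hlogp : Real.log ((1 + θ) * β) = Real.log (1 + θ) + Real.log β :=
    Real.log_mul (by linarith : (1 + θ) ≠ 0) hβ.ne'
  have hlogm : Real.log ((1 - θ) * β) = Real.log (1 - θ) + Real.log β :=
    Real.log_mul (by linarith : (1 - θ) ≠ 0) hβ.ne'
  rw [hlogp] at hp
  rw [hlogm] at hm
  have l1 := log_one_add_le_of_nonneg hθ.le
  have l2 := sub_sq_le_log_one_add_of_nonneg hθ.le
  have l3 := log_one_sub_le_neg (by linarith : θ < 1)
  have l4 := neg_sub_two_sq_le_log_one_sub hθ2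
  rw [abs_le] at hm h0 hp
  obtain ⟨hm1, hm2⟩ := hm
  obtain ⟨h01, h02⟩ := h0
  obtain ⟨hp1, hp2⟩ := hp
  -- θ · (β F′ + B) is squeezed between −2ε − 2|B|θ² and 2ε + |B|θ².
  have m1 : |B * (Real.log (1 + θ) - θ)| ≤ |B| * θ ^ 2 := by
    rw [abs_mul]
    refine mul_le_mul_of_nonneg_left ?_ (abs_nonneg B)
    rw [abs_le]; constructor <;> nlinarith [sq_nonneg θ]
  have m2 : |B * (Real.log (1 - θ) + θ)| ≤ |B| * (2 * θ ^ 2) := by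
    rw [abs_mul]
    refine mul_le_mul_of_nonneg_left ?_ (abs_nonneg B)
    rw [abs_le]; constructor <;> nlinarith [sq_nonneg θ]
  have n1 := neg_le_abs (B * (Real.log (1 + θ) - θ))
  have n2 := neg_abs_le (B * (Real.log (1 - θ) + θ))
  have up : θ * (β * deriv F β + B) ≤ 2 * ε + |B| * θ ^ 2 := by
    have e : θ * (β * deriv F β + B) = θ * β * deriv F β + B * θ := by ring
    have e2 : B * (Real.log (1 + θ) - θ) = B * Real.log (1 + θ) - B * θ := by ring
    rw [e]
    rw [e2] at n1 m1
    linarith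
  have lo : -(2 * ε) - |B| * (2 * θ ^ 2) ≤ θ * (β * deriv F β + B) := by
    have e : θ * (β * deriv F β + B) = θ * β * deriv F β + B * θ := by ring
    have e2 : B * (Real.log (1 - θ) + θ) = B * Real.log (1 - θ) + B * θ := by ring
    rw [e]
    rw [e2] at n2 m2
    linarith
  set X := β * deriv F β + B with hX
  set q := 2 * ε / θ with hq
  have hqθ : q * θ = 2 * ε := by rw [hq]; exact div_mul_cancel₀ (2 * ε) hθ.ne'
  have hBθ : 0 ≤ |B| * θ ^ 2 := mul_nonneg (abs_nonneg B) (sq_nonneg θ)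
  rw [abs_le]
  constructor
  · -- lower
    by_contra hc
    push Not at hc
    have h1 : θ * X < θ * (-(2 * |B| * θ + q)) := mul_lt_mul_of_pos_left hc hθ
    have h2 : θ * (-(2 * |B| * θ + q)) = -(2 * |B| * θ ^ 2) - 2 * ε := by
      linear_combination (-1 : ℝ) * hqθ
    linarith
  · -- upper
    by_contra hc
    push Not at hc
    have h1 : θ * (2 * |B| * θ + q) < θ * X := mul_lt_mul_of_pos_left hc hθ
    have h2 : θ * (2 * |B| * θ + q) = 2 * |B| * θ ^ 2 + 2 * ε := by
      linear_combination hqθ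
    linarith

/-! ### Uniform (family) version and the single-function limit -/

/-- Lemma 10.2 of the seat's paper, UNIFORM version.  A family `F i` of convex differentiable functions on
`(0,∞)`, an admissibility predicate `adm i β` that is down-closed in `β`, and
`|F i β + B log β − K| ≤ ε` eventually, uniformly on admissible pairs, imply
`|β (F i)′(β) + B| ≤ e` eventually, uniformly on pairs with `adm i (2β)`.  (For the lattice Yang–Mills
tori: `i = S`, `adm S β := β^{1+υ} ≤ 2S+1`, `B = 3 dim G / 2`, and `−(F S)′/6` = the plaquette energy.) -/
theorem deriv_asymp_uniform_of_convexOn {ι : Type*} (F : ι → ℝ → ℝ) (adm : ι → ℝ → Prop)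
    (B K : ℝ)
    (hdown : ∀ i β β', adm i β → β' ≤ β → adm i β')
    (hconv : ∀ i, ConvexOn ℝ (Ioi 0) (F i))
    (hdiff : ∀ i x, 0 < x → DifferentiableAt ℝ (F i) x)
    (hlim : ∀ ε > 0, ∃ β₀ : ℝ, ∀ i β, adm i β → β₀ ≤ β → |F i β + B * Real.log β - K| ≤ ε) :
    ∀ e > 0, ∃ β₁ : ℝ, ∀ i β, adm i (2 * β) → β₁ ≤ β → |β * deriv (F i) β + B| ≤ e := by
  intro e he
  have hB1 : 0 < |B| + 1 := by positivity
  set θ := min (1 / 2 : ℝ) (e / (8 * (|B| + 1))) with hθdef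
  have hθpos : 0 < θ := lt_min (by norm_num) (by positivity)
  have hθhalf : θ ≤ 1 / 2 := min_le_left _ _
  have hθe : 2 * |B| * θ ≤ e / 4 := by
    have hθ' : θ ≤ e / (8 * (|B| + 1)) := min_le_right _ _
    have step : 2 * |B| * θ ≤ 2 * |B| * (e / (8 * (|B| + 1))) :=
      mul_le_mul_of_nonneg_left hθ' (by positivity)
    have e1 : 2 * |B| * (e / (8 * (|B| + 1))) = (e / 4) * (|B| / (|B| + 1)) := by
      field_simp; ring
    have e2 : |B| / (|B| + 1) ≤ 1 := (div_le_one hB1).mpr (by linarith)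
    have e3 : (e / 4) * (|B| / (|B| + 1)) ≤ (e / 4) * 1 :=
      mul_le_mul_of_nonneg_left e2 (by positivity)
    linarith
  obtain ⟨β₀, hβ₀⟩ := hlim (e * θ / 8) (by positivity)
  refine ⟨max (2 * β₀) 2, ?_⟩
  intro i β hadm hβ
  have hβ2 : 2 ≤ β := le_trans (le_max_right _ _) hβ
  have hβpos : 0 < β := by linarith
  have hββ₀ : 2 * β₀ ≤ β := le_trans (le_max_left _ _) hβ
  have t1 : 0 ≤ θ * β := mul_nonneg hθpos.le hβpos.le
  have t2 : 0 ≤ (1 / 2 - θ) * β := mul_nonneg (by linarith) hβpos.le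
  have ap : adm i ((1 + θ) * β) := hdown i (2 * β) _ hadm (by nlinarith)
  have a0 : adm i β := hdown i (2 * β) _ hadm (by linarith)
  have am : adm i ((1 - θ) * β) := hdown i (2 * β) _ hadm (by nlinarith)
  have bm : β₀ ≤ (1 - θ) * β := by nlinarith
  have b0 : β₀ ≤ β := by linarith
  have bp : β₀ ≤ (1 + θ) * β := by nlinarith
  have key := abs_mul_deriv_add_le_of_convexOn (hconv i) hβpos hθpos hθhalf (hdiff i β hβpos)
    (hβ₀ i _ am bm) (hβ₀ i _ a0 b0) (hβ₀ i _ ap bp)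
  have e4 : 2 * (e * θ / 8) / θ = e / 4 := by
    field_simp; ring
  rw [e4] at key
  linarith

/-- Lemma 10.2 of the seat's paper, single function: if `F` is convex and differentiable on `(0,∞)` and
`F(β) + B log β → K` as `β → ∞`, then `β F′(β) → −B`. -/
theorem tendsto_mul_deriv_of_convexOn {F : ℝ → ℝ} {B K : ℝ}
    (hconv : ConvexOn ℝ (Ioi 0) F) (hdiff : ∀ x, 0 < x → DifferentiableAt ℝ F x)
    (hlim : Tendsto (fun β => F β + B * Real.log β) atTop (𝓝 K)) :
    Tendsto (fun β => β * deriv F β) atTop (𝓝 (-B)) := by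
  rw [Metric.tendsto_atTop]
  intro e he
  have hlim' : ∀ ε > 0, ∃ β₀ : ℝ, ∀ (i : Unit) (β : ℝ), True → β₀ ≤ β →
      |F β + B * Real.log β - K| ≤ ε := by
    intro ε hε
    obtain ⟨N, hN⟩ := (Metric.tendsto_atTop.mp hlim) ε hε
    refine ⟨N, fun _ β _ hβ => ?_⟩
    have h := hN β hβ
    rw [Real.dist_eq] at h
    exact h.le
  obtain ⟨β₁, h⟩ := deriv_asymp_uniform_of_convexOn (fun _ : Unit => F) (fun _ _ => True) B K
    (fun _ _ _ _ _ => trivial) (fun _ => hconv) (fun _ x hx => hdiff x hx) hlim' (e / 2)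
    (by positivity)
  refine ⟨β₁, fun β hβ => ?_⟩
  have hb := h () β trivial hβ
  rw [Real.dist_eq, show β * deriv F β - -B = β * deriv F β + B by ring]
  exact lt_of_le_of_lt hb (by linarith)

end Summit.QuantumFields.YangMills.Theorems

end
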